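import Summits.Ventures.WeilGRH.UniformConductorFloorLog12Table
import HarnessLib

/-!
# GRH arm (rh-explicit, venture WeilGRH): the special-value table at `a = (log 12)/2` — validity of the constants, the prime data and the records of
  the modes `0 … 19` (kernel certificates, part A of seven)

Cell `rh-explicit`, WEIL TRACK — GRH ARM (weil-grh-1, gen9).  Kernel re-verification of every datum of `UniformConductorFloorLog12Table.lean` in the
format of `WeilFormatCDataLog3HalfTabValid.lean` (weil-2): `checkPi` (Machin, 70 terms), `checkHalfLogNat` (`a = (log 12)/2`), `checkConsts`,
`checkPrimeDataHalfLog 12`, and — in the seven parts A–G, 20 modes each (G: 8) (≈ 4 s per mode in the kernel), parts B–G importing only this part so that they file in parallel — `checkTable` slices recomputing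
`Encl.idxRec` at every mode and testing containment, glued into `tab_valid : TabValid (2^80) a ks 128 tab` in `UniformConductorFloorLog12TableValid.lean` (gen10 re-cut of gen9's sequential chain; the prime-constant floors at this window are certified inside each cell by `TwistedEncl.checkFloors`, no exact boundary occurring at `(log 12)/2`).  With `consts_valid` /
`primeData` / `tab_valid` the table is a drop-in input for weil-grh-2's twisted cell kits (`TwistedEncl.twistedGramBox`, `evenBox` / `oddBox`, door E)
at this window.  No definitions; no named facts; standard axioms.
[cite: Yoshida1992HermitianForms, §5 (5.15)-(5.16) p. 301; Moore1966, Ch. 3 (interval arithmetic: inclusion property)]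
-/

set_option maxRecDepth 200000

namespace Summit.Ventures.WeilGRH.Log12Table
open Literature.NumberTheory.LFunctions Literature.NumberTheory.LFunctions.Yoshida1992 Encl Literature.Analysis.ValidatedNumerics.NumericsMP

/-- kernel: `P ∋ π`. [cite: Moore1966, Ch. 3 (interval arithmetic: inclusion property)] -/
theorem tP : checkPi (2 ^ 80) 70 P = true := by decide +kernel

/-- kernel: `A ∋ (log 12)/2`. [cite: Moore1966, Ch. 3 (interval arithmetic: inclusion property)] -/
theorem tA : checkHalfLogNat (2 ^ 80) 96 12 A = true := by decide +kernel

/-- kernel: the constants record is valid. [cite: Moore1966, Ch. 3 (interval arithmetic: inclusion property)] -/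
theorem tC : checkConsts prm P A ks C = true := by decide +kernel

/-- kernel: the prime data of the window `(log 12)/2`. [cite: Yoshida1992HermitianForms, §5 (5.15) p. 301] -/
theorem tK : checkPrimeDataHalfLog 12 ks = true := by decide +kernel

/-- `π ∈ P`. [cite: Moore1966, Ch. 3 (interval arithmetic: inclusion property)] -/
theorem pi_mem : MI.mem (2 ^ 80) Real.pi P := mem_pi_of_checkPi (by norm_num) tP

/-- `a ∈ A`. [cite: Moore1966, Ch. 3 (interval arithmetic: inclusion property)] -/
theorem a_mem : MI.mem (2 ^ 80) a A := by
  unfold a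
  exact mem_of_checkHalfLogNat (S := 2 ^ 80) (by norm_num) tA

/-- `0 < a`. [folklore] -/
theorem a_pos : (0 : ℝ) < a := by
  unfold a
  have : (1 : ℝ) < 12 := by norm_num
  positivity

/-- The constants are valid for `a = (log 12)/2`. [cite: Moore1966, Ch. 3 (interval arithmetic: inclusion property)] -/
theorem consts_valid : ConstsValid (2 ^ 80) a ks C :=
  constsValid_of_checkConsts (prm := prm) (by norm_num [prm]) (by norm_num [prm]) pi_mem a_mem tC

/-- The prime data is valid for `a = (log 12)/2`. [cite: Yoshida1992HermitianForms, §5 (5.15) p. 301] -/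
theorem primeData : PrimeData a ks := by
  have h := primeData_of_checkHalfLog tK
  unfold a; exact_mod_cast h

/-- kernel: table slice `[0, 20)`. [cite: Moore1966, Ch. 3 (interval arithmetic: inclusion property)] -/
theorem tT0 : checkTable prm C tab 0 20 = true := by decide +kernel

/-- The table is valid below `20`. [cite: Moore1966, Ch. 3 (interval arithmetic: inclusion property)] -/
theorem tab_valid20 : TabValid (2 ^ 80) a ks (0 + 20) tab :=
  TabValid.zero.extend fun n hn hnk ↦ idxValid_of_checkTable (prm := prm) (by norm_num [prm]) a_pos consts_valid tT0 hn hnk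

end Summit.Ventures.WeilGRH.Log12Table
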